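import Summits.ResolutionOfSingularities.ResolutionOfSingularities.Theorems.EquisingularLiftEquisingularLiftNatTCPlusMemberCluster
import Summits.ResolutionOfSingularities.ResolutionOfSingularities.Theorems.EquisingularLiftEquisingularLiftNatTCPlusPlusInvBasePrep
import Summits.ResolutionOfSingularities.ResolutionOfSingularities.Theorems.EquisingularLiftEquisingularLiftNatClusterPointPackage
import Summits.ResolutionOfSingularities.ResolutionOfSingularities.Theorems.EquisingularLiftEquisingularLiftNatClusterConeSubset
import HarnessLib

/-!
# [OURS · L1 W4.5(b) · EL♮(3)] (δ) D6 INV″-BASE: THE TC⁺⁺ INVARIANT AT THE FIRST POINT STEP, `TCPlusPlus.Inv … W F₂ (𝟙 F₂) T₂ Z₂ ∅` —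
# the `hbase` binder of res-L1-w45b-stub-3's driver `hsub_reachTCPlusPlus_of_invariant` (p543222) at `INV := TCPlusPlus.Inv` (p547095)

Crux chain w45b (cell `res-hironaka`, slot W4.5(b)), working crux **EL♮** = stmt-ResolutionOfSingularities-20038, child **EL♮(3)** =
stmt-ResolutionOfSingularities-20148, route EquisingularLift, line `sections`, registered stub `stub_elnat_tcPlusPlusPointResolution` (v2); brick
(δ) = TC⁺⁺ STEP 0 PER SUBSET of res-L1-w45b-stub-3's `DELTA-PLAN.md` (res-L1-w45b-plan-1 BOOKING 2026-08-27T16:20:41Z: D5/D6 := res-type-100).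
HONEST FRAMING: OURS; NOT a statement of any manuscript; AI-written, weaker than expert review. No `sorry`; standard axioms. DEF-FREE.
`--supports stmt-ResolutionOfSingularities-20148 --as helper`.

WHAT. **`inv_base''`**: in the binders of res-type-100's B9 `inv_base` (p548088: the driver's point step at relative dimension `3`) with the germ
`W` and ITS CARRIER CLUSTER `CarrierCluster₂ F₁ F₂ υ x W` (res-L1-w45b-lead-2 …NatClusterStepTangentDefs p536699) in place of the rung-v7
`W`-clauses: `TCPlusPlus.Inv O k θ P q Y Ch W F₂ (𝟙 F₂) T₂ Z₂ ∅` — `F₂` integral, `T₂ = closure υ⁻¹(T₁ ∖ {x})` closed irreducible and not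
inside `closure Z₂`, and FOR EVERY `S′ ⊆ Cand F₂ Z₂ ∅` a member `TCPlus.Member … F₂ T₂ Z₂ S′`. ASSEMBLY: unpack the cluster (frame `c̄`, `Φ₁`,
`πk`, `g`, fat cluster `(s, i, a, m)`); lift the frame to a section frame `c` at `j x` (…InvBasePrep `exists_sectionFrame_lift_model` over
res-D-pv-051 p550981); `πO = πk ∘ j♯ ∘ ι`, `O`-lifts `aO` of the coordinates; `g` square-free (…InvBasePrep); the CLUSTER POINTS `y′ t` (res-type-100
D3 `exists_clusterPoint` p551356) and `S := y′⁻¹ S′` with `y′ '' S = S′` (D3c `cand_subset_range_clusterPoint` p554627); THE CONE `Φ_S`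
(res-L1-w45b-stub-3 D1 `exists_clusterConeLift_subset` p548257) and its prescribed-germ divisor `K₀`; the centred packages at the points of `S`
(res-L1-w45b-stub-3 D4 `tcPlus_centredPackage_clusterPoint`, `hm1` by …InvBasePrep); then res-type-100's D5 `tcPlus_member_cluster` (p557739).
-/

set_option linter.dupNamespace false -- mandated namespace `Summit.<Summit>.<Problem>` of this single-conjunct summit
set_option linter.overlappingInstances false -- the binders carry `[IsDomain O] [IsDiscreteValuationRing O]`

noncomputable section

open CategoryTheory CategoryTheory.Limits AlgebraicGeometry TopologicalSpace IsLocalRing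
open Literature.AlgebraicGeometry.Resolution
open AlgebraicGeometry.Scheme.IdealSheafData
open Summit.ResolutionOfSingularities.ResolutionOfSingularities.Cruxes.EquisingularLift.StrataSplit

namespace Summit.ResolutionOfSingularities.ResolutionOfSingularities.Cruxes.EquisingularLiftNat.Sections

set_option maxHeartbeats 3200000 in -- long assembly over the chart algebra `blowupAlgebra` (slow instance unification, cf. B8/B9)
/-- **THE TC⁺⁺ INVARIANT AT THE FIRST POINT STEP** (`TCPlusPlus.Inv … W F₂ (𝟙 F₂) T₂ Z₂ ∅`, the driver's `hbase`; see the module docstring).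
[cite: Matsumura1987, Thm. 14.2; StacksProject, Tag 0804] [OURS · L1 W4.5b] (δ) D6 toward `stub_elnat_tcPlusPlusPointResolution`; NOT a
statement of the manuscript. -/
theorem inv_base'' (k : Type) [Field k] [IsAlgClosed k] (O : Type) [CommRing O] [IsDomain O]
    [IsDiscreteValuationRing O] [IsAdicComplete (IsLocalRing.maximalIdeal O) O] [IsAlgClosed (IsLocalRing.ResidueField O)]
    (θ : O →+* k) (hθ : Function.Surjective θ) (P : Scheme.{0}) (q : P ⟶ Spec (.of O)) (Y : Set P)
    (Ch : ∀ X' : Scheme.{0}, (X' ⟶ P) → Set X' → Prop)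
    (hChSplit : ∀ (X' : Scheme.{0}) (σ' : X' ⟶ P) (S' : Set X'), Ch X' σ' S' →
      Summit.ResolutionOfSingularities.ResolutionOfSingularities.Theses.EquisingularLift.Split.Chain P Y X' σ' S')
    (hPnoeth : IsLocallyNoetherian P) (hPreg : Scheme.IsRegular P) [IsProper q]
    (X' : Scheme.{0}) (σ' : X' ⟶ P) (S' : Set X') (hCh' : Ch X' σ' S') [IsIntegral X'] [IsLocallyNoetherian X']
    (hX'reg : Scheme.IsRegular X') (F₁ : Scheme.{0}) [IsIntegral F₁] (j : F₁ ⟶ X') (t : F₁ ⟶ Spec (.of k))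
    (hsq : IsPullback j t (σ' ≫ q) (Spec.map (CommRingCat.ofHom θ))) (T₁ : Set F₁) (x : F₁) (hx : IsClosed ({x} : Set F₁))
    (s : Spec (.of O) ⟶ X') (hs : s ≫ σ' ≫ q = 𝟙 _) (hsx : s (IsLocalRing.closedPoint O) = j x)
    (hdim : ringKrullDim (X'.presheaf.stalk (s (IsLocalRing.closedPoint O))) = ((3 + 1 : ℕ) : WithBot ℕ∞))
    (hsoff : ∀ c ∈ (s.ker.support : Set X'), ¬ IsGenericPoint (σ' c) Y)
    (X₁ : Scheme.{0}) (τ₁ : X₁ ⟶ X') (hτ₁ : IsBlowup τ₁ s.ker) [IsIntegral X₁] [IsLocallyNoetherian X₁]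
    (hX₁reg : Scheme.IsRegular X₁) (hX₁dom : IsDominant ((τ₁ ≫ σ') ≫ q))
    (F₂ : Scheme.{0}) [IsIntegral F₂] (υ : F₂ ⟶ F₁) (hυ : IsBlowup υ (vanishingIdeal (⟨{x}, hx⟩ : Closeds F₁)))
    (j₂ : F₂ ⟶ X₁) (t₂ : F₂ ⟶ Spec (.of k)) (hsq₂ : IsPullback j₂ t₂ ((τ₁ ≫ σ') ≫ q) (Spec.map (CommRingCat.ofHom θ)))
    (hcomm : j₂ ≫ τ₁ = υ ≫ j) (hcarrier : (s.ker.comap τ₁).comap j₂ = (vanishingIdeal (⟨{x}, hx⟩ : Closeds F₁)).comap υ)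
    (hCh₁ : Ch X₁ (τ₁ ≫ σ') (j₂ '' closure (υ ⁻¹' (T₁ \ {x}))))
    (hirr₂ : IsIrreducible (closure (υ ⁻¹' (T₁ \ {x}))))
    (W : Set F₁) (hCC : CarrierCluster₂ F₁ F₂ υ x W) :
    TCPlusPlus.Inv O k θ P q Y Ch W F₂ (𝟙 F₂) (closure (υ ⁻¹' (T₁ \ {x}))) (υ ⁻¹' {x} ∩ closure (υ ⁻¹' (W \ {x}))) ∅ := by
  classical
  have hZ : IsClosed (υ ⁻¹' {x} ∩ closure (υ ⁻¹' (W \ {x}))) := (hx.preimage υ.continuous).inter isClosed_closure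
  refine ⟨‹_›, isClosed_closure, hirr₂, fun hsub => ?_, fun S₀ hS₀ => ?_⟩
  · -- `T₂ ⊄ closure Z₂ = Z₂ ⊆ υ⁻¹{x}` (B9 verbatim)
    obtain ⟨y, hyT⟩ := closure_nonempty_iff.mp hirr₂.nonempty
    have hyZ := hZ.closure_subset (hsub (subset_closure hyT))
    exact hyT.2 hyZ.1
  -- instances (B8 verbatim)
  haveI : IsProper σ' := (chain_isRegular P Y X' σ' S' (hChSplit X' σ' S' hCh') hPnoeth hPreg).2.2
  haveI : IsProper (σ' ≫ q) := inferInstance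
  haveI : IsProper τ₁ := hτ₁.isProper
  haveI : IsClosedImmersion (Spec.map (CommRingCat.ofHom θ)) := IsClosedImmersion.spec_of_surjective _ hθ
  haveI : IsClosedImmersion j := MorphismProperty.IsStableUnderBaseChange.of_isPullback hsq.flip inferInstance
  haveI : LocallyOfFiniteType t := MorphismProperty.IsStableUnderBaseChange.of_isPullback hsq inferInstance
  haveI : IsLocallyNoetherian F₁ := LocallyOfFiniteType.isLocallyNoetherian j
  haveI : IsProper υ := hυ.isProper
  haveI : IsLocallyNoetherian F₂ := LocallyOfFiniteType.isLocallyNoetherian υ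
  haveI : JacobsonSpace F₁ := LocallyOfFiniteType.jacobsonSpace t
  obtain ⟨ϖ, hϖ⟩ := IsDiscreteValuationRing.exists_irreducible O
  have hϖO : ϖ ∈ maximalIdeal O := by rw [hϖ.maximalIdeal_eq]; exact Ideal.mem_span_singleton_self ϖ
  have hdimx : ringKrullDim (X'.presheaf.stalk (j x)) = ((3 + 1 : ℕ) : WithBot ℕ∞) := by rw [← hsx]; exact hdim
  -- (0) unpack the carrier cluster
  obtain ⟨cb, d₁, Φ₁, ⟨hcb𝔪, hΦ₁d, hΦ₁0, hW⟩, k', _, πk, hπk, hkerπ, dg, g, ⟨hgdg, hR1, hR1', hR2⟩, ns, i, a, m, hF, hns, htw⟩ :=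
    hCC
  -- (1) the section frame `c` at `j x` over `c̄` (…InvBasePrep), and its frame data for every uniformizer
  obtain ⟨c, hcI, hcb⟩ := exists_sectionFrame_lift_model O k θ hθ (σ' ≫ q) s hs j t hsq x hsx (hX'reg (j x)) ϖ hϖ cb hcb𝔪
  obtain rfl : cb = fun l => (j.stalkMap x).hom (c l) := funext fun l => (hcb l).symm
  obtain ⟨θR, hqr, hdom, hθR, h𝔪, hϖc⟩ :=
    exists_sectionFrame_of_span_eq_forall_at O (σ' ≫ q) s hs (j x) hsx (hX'reg (j x)) ϖ hϖ c hcI hdimx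
  haveI := hdom
  have hframe : ∀ ϖ' : O, Irreducible ϖ' →
      Ideal.span (Set.range c) ⊔ Ideal.span {((Scheme.ΓSpecIso (.of O)).inv ≫ (σ' ≫ q).appTop ≫ X'.presheaf.Γgerm (j x)).hom ϖ'} =
        maximalIdeal (X'.presheaf.stalk (j x)) ∧
      ((Scheme.ΓSpecIso (.of O)).inv ≫ (σ' ≫ q).appTop ≫ X'.presheaf.Γgerm (j x)).hom ϖ' ∉ Ideal.span (Set.range c) := by
    intro ϖ' hϖ'
    obtain ⟨θ', -, -, -, h𝔪', hϖc'⟩ :=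
      exists_sectionFrame_of_span_eq_forall_at O (σ' ≫ q) s hs (j x) hsx (hX'reg (j x)) ϖ' hϖ' c hcI hdimx
    exact ⟨h𝔪', hϖc'⟩
  have hcbar := isQuasiRegular_stalkMap_model O k θ hθ (σ' ≫ q) j t hsq x c hqr ϖ hϖ hϖc
  -- (2) the residue model `πO = πk ∘ j♯ ∘ ι` of `O`: surjective, kernel `(ϖ)`, infinite target
  set ι := ((Scheme.ΓSpecIso (.of O)).inv ≫ (σ' ≫ q).appTop ≫ X'.presheaf.Γgerm (j x)).hom with hιdef
  let πO : O →+* k' := πk.comp ((j.stalkMap x).hom.comp ι)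
  have hπO : ∀ b : O, πk ((j.stalkMap x).hom (ι b)) = πO b := fun b => rfl
  have hπ₀ := residueModel_surjective_and_ker θ hθ (σ' ≫ q) j t hsq x c θR hθR hcb𝔪 rfl
  have hkerπO𝔪 : RingHom.ker πO = maximalIdeal O := by
    ext b
    rw [← hπ₀.2, RingHom.mem_ker, RingHom.mem_ker, ← hπO]
    change _ ↔ Ideal.Quotient.mk _ ((j.stalkMap x).hom _) = 0
    rw [Ideal.Quotient.eq_zero_iff_mem, ← hkerπ, RingHom.mem_ker]
  have hkerπO : RingHom.ker πO = Ideal.span {ϖ} := by rw [hkerπO𝔪, hϖ.maximalIdeal_eq]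
  have hπOsurj : Function.Surjective πO := by
    intro v
    obtain ⟨u, rfl⟩ := hπk v
    obtain ⟨b, hb⟩ := hπ₀.1 (Ideal.Quotient.mk _ u)
    refine ⟨b, ?_⟩
    change Ideal.Quotient.mk _ ((j.stalkMap x).hom (ι b)) = Ideal.Quotient.mk _ u at hb
    have hdiff : (j.stalkMap x).hom (ι b) - u ∈ RingHom.ker πk := by rw [hkerπ]; exact (Ideal.Quotient.eq).mp hb
    rw [RingHom.mem_ker, map_sub, sub_eq_zero] at hdiff
    rw [← hπO]; exact hdiff
  let ek : (F₁.presheaf.stalk x ⧸ Ideal.span (Set.range fun l => (j.stalkMap x).hom (c l))) ≃+* k' :=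
    (Ideal.quotEquivOfEq hkerπ.symm).trans (RingHom.quotientKerEquivOfSurjective hπk)
  have hek : ek.toRingHom.comp (Ideal.Quotient.mk (Ideal.span (Set.range fun l => (j.stalkMap x).hom (c l)))) = πk :=
    RingHom.ext fun r => by
      change RingHom.quotientKerEquivOfSurjective hπk (Ideal.quotEquivOfEq hkerπ.symm (Ideal.Quotient.mk _ r)) = πk r
      rw [Ideal.quotEquivOfEq_mk, RingHom.quotientKerEquivOfSurjective_apply_mk]
  haveI : Infinite k' := by
    haveI : Infinite (IsLocalRing.ResidueField O) := inferInstance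
    let e : IsLocalRing.ResidueField O ≃+* k' :=
      (Ideal.quotEquivOfEq hkerπO𝔪.symm).trans (RingHom.quotientKerEquivOfSurjective hπOsurj)
    exact Infinite.of_injective e e.injective
  -- (3) `O`-lifts of the cluster coordinates
  choose aO haO using fun (t' : Fin ns) (l : {l : Fin 3 // l ≠ i t'}) => hπOsurj (a t' l)
  obtain rfl : a = fun t' l => πO (aO t' l) := funext fun t' => funext fun l => (haO t' l).symm
  -- (4) `g ≠ 0` and square-free
  have hg0 : g ≠ 0 := by
    intro hg
    obtain ⟨n, hn⟩ := hR1
    rw [hg, Ideal.span_singleton_eq_bot.mpr rfl, Ideal.mem_bot] at hn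
    have h1 : MvPolynomial.map πk Φ₁ = 0 := by
      by_cases hn0 : n = 0
      · subst hn0; rw [pow_zero] at hn; exact absurd hn one_ne_zero
      · exact (pow_eq_zero_iff hn0).mp hn
    apply hΦ₁0
    apply MvPolynomial.map_injective ek.toRingHom ek.injective
    rw [MvPolynomial.map_map, hek, h1, map_zero]
  have hgsq : Squarefree g := squarefree_of_isHomogeneous_of_isRadical_dehomogenize hgdg hg0 (0 : Fin 3) 1 (by decide) hR2
  -- (5) the cluster points (D3 part 1)
  have Hpt := fun t' : Fin ns => exists_clusterPoint hx hυ (fun l => (j.stalkMap x).hom (c l)) hcbar πk hπk hkerπ (i t')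
    (fun l => πO (aO t' l)) (fun l => (j.stalkMap x).hom (ι (aO t' l))) (fun l => hπO (aO t' l))
  choose y' hy'x hy'cl 𝔮p χp ep hχp hlocp hep h𝔮p hmaxp hfrp using Hpt
  -- (6) the subset `S` of the cluster indexing `S₀`, and THE CONE `Φ_S` (res-L1-w45b-stub-3's D1)
  set S : Set (Fin ns) := {t' | y' t' ∈ S₀} with hSdef
  obtain ⟨ΦS, hΦSd, hΦSg, hcen, hexact, hΔ, hst⟩ :=
    exists_clusterConeLift_subset hϖ πO hπOsurj hkerπO g hgdg hg0 hgsq i aO m hF hns htw S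
  -- (7) the cone upstairs: `Φ_S ≠ 0`, `ι_*Φ_S ≢ 0 mod (c)`, its prescribed-germ divisor `K₀`
  have hρ₀ : (θR.toRingHom.comp (Ideal.Quotient.mk (Ideal.span (Set.range c)))).comp ι = RingHom.id O :=
    RingHom.ext fun b => hθR b
  have hΦne : ΦS ≠ 0 := fun h0 => hg0 (by rw [← hΦSg, h0, map_zero])
  have hΦι : MvPolynomial.map (Ideal.Quotient.mk (Ideal.span (Set.range c))) (MvPolynomial.map ι ΦS) ≠ 0 := by
    intro h
    apply hΦne
    have h2 := congrArg (MvPolynomial.map θR.toRingHom) h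
    rwa [MvPolynomial.map_map, MvPolynomial.map_map, hρ₀, MvPolynomial.map_id, map_zero] at h2
  have hΦιd : (MvPolynomial.map ι ΦS).IsHomogeneous dg := hΦSd.map _
  obtain ⟨K₀, hK₀pr, hK₀⟩ := exists_forall_isPrincipal_stalkIdeal_eq_span hX'reg (j x) (eval_ne_zero_of_isQuasiRegular hqr hΦιd hΦι)
  -- (8) the image `G` of the cone downstairs and the reduced-cone relations modulo `(c̄)`
  have hGg : MvPolynomial.map πk (MvPolynomial.map (j.stalkMap x).hom (MvPolynomial.map ι ΦS)) = g := by
    rw [MvPolynomial.map_map, MvPolynomial.map_map, ← hΦSg]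
    exact congrArg (MvPolynomial.map · ΦS) (RingHom.ext fun b => hπO b)
  obtain ⟨hΦG, hGΦ, hGrad, -⟩ := reducedCone_relations_of_residueModel (fun l => (j.stalkMap x).hom (c l)) πk hπk hkerπ Φ₁ _
    hGg hR1 hR1' hR2 hg0
  -- (9) `S₀ = y′ '' S` (D3c COVER) and the points of `S` lie on the carrier curve
  have hZcl : υ ⁻¹' {x} ∩ closure (υ ⁻¹' (W \ {x})) =
      υ ⁻¹' {x} ∩ closure (υ ⁻¹' (((⟨closure W, isClosed_closure⟩ : Closeds F₁) : Set F₁) \ {x})) := by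
    rw [Closeds.coe_mk, ← closure_preimage_diff_singleton_eq_of_isBlowup hx hυ W]
  have hZ' : IsClosed (υ ⁻¹' {x} ∩ closure (υ ⁻¹' (((⟨closure W, isClosed_closure⟩ : Closeds F₁) : Set F₁) \ {x}))) :=
    hZcl ▸ hZ
  rw [hZcl] at hS₀
  have hcover := cand_subset_range_clusterPoint hx hυ (fun l => (j.stalkMap x).hom (c l)) hcb𝔪 hcbar πk hπk hkerπ
    ⟨closure W, isClosed_closure⟩ Φ₁ _ hΦ₁d hΦ₁0 hW hΦG hGΦ hGrad (by rw [hGg]; exact hgdg) (by rw [hGg]; exact hg0) i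
    (fun t' l => πO (aO t' l)) m (by rw [hGg]; exact hF) y' hy'x 𝔮p χp hχp hlocp h𝔮p (fun t' l => (j.stalkMap x).hom (ι (aO t' l)))
    (fun t' l => hπO (aO t' l)) hfrp
  have hS₀eq : y' '' S = S₀ := by
    ext z
    constructor
    · rintro ⟨t', ht', rfl⟩; exact ht'
    · intro hz
      obtain ⟨t', rfl⟩ := hcover (hS₀ hz)
      exact ⟨t', hz, rfl⟩
  have hmemZ : ∀ t' ∈ S, y' t' ∈ υ ⁻¹' {x} ∩ closure (υ ⁻¹' (((⟨closure W, isClosed_closure⟩ : Closeds F₁) : Set F₁) \ {x})) := by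
    intro t' ht'
    obtain ⟨-, -, y'', hy'', -⟩ := hS₀ ht'
    have h := Set.mem_range_self (f := fun z => ((vanishingIdeal (⟨closure (υ ⁻¹' {x} ∩ closure (υ ⁻¹'
      (((⟨closure W, isClosed_closure⟩ : Closeds F₁) : Set F₁) \ {x}))), isClosed_closure⟩ : Closeds F₂)).subschemeι z : F₂)) y''
    rw [Scheme.IdealSheafData.range_subschemeι, Scheme.IdealSheafData.coe_support_vanishingIdeal] at h
    rw [← hy'']
    exact hZ'.closure_subset h
  -- (10) the centred packages at the points of `S` (res-L1-w45b-stub-3's D4, `hm1` by …InvBasePrep)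
  have hpkg : ∀ t' ∈ S, TCPlus.CentredPackage O P q X₁ (τ₁ ≫ σ') (s.ker.comap τ₁) (strictTransformIdeal τ₁ s.ker K₀) (j₂ (y' t')) := by
    intro t' ht'
    have hm1 : 1 ≤ m t' :=
      one_le_of_clusterPoint_mem_carrierTrace hx (fun l => (j.stalkMap x).hom (c l)) hcb𝔪 hcbar πk hkerπ
        ⟨closure W, isClosed_closure⟩ Φ₁ _ hΦ₁d hΦ₁0 hW hΦG hGΦ hGrad hZ' (i t') (fun l => πO (aO t' l)) (m t')
        (by rw [hGg]; exact (hF.1 t').2) (y' t') (hy'x t') (𝔮p t') (χp t') (hχp t') (hlocp t') (h𝔮p t')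
        (fun l => (j.stalkMap x).hom (ι (aO t' l))) (fun l => hπO (aO t' l)) (hfrp t') (hmemZ t' ht')
    exact TCPlus.tcPlus_centredPackage_clusterPoint k O θ hθ P q X' σ' hX'reg F₁ j t hsq x hx s hs hsx hdimx X₁ τ₁ hτ₁ hX₁reg F₂ υ hυ
      j₂ t₂ hsq₂ hcomm hcarrier ϖ hϖ c hcI (i t') (aO t')
      (Fin.cases (c (i t')) fun l : Fin 2 => c ((i t').succAbove l) - ι (aO t' ⟨(i t').succAbove l, Fin.succAbove_ne (i t') l⟩) * c (i t'))
      rfl (fun l => rfl) (y' t') (hy'x t') (hy'cl t') ⟨𝔮p t', χp t', ep t', hχp t', hlocp t', hep t', h𝔮p t', hfrp t'⟩ ΦS hm1 hΦSd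
      (hcen t' ht') (hexact t' ht') (hst t' ht') K₀ hK₀
  -- (11) the member centred at `S` (res-type-100's D5)
  have hmem := tcPlus_member_cluster k O θ hθ P q Y Ch hChSplit hPnoeth hPreg X' σ' S' hCh' hX'reg F₁ j t hsq T₁ x hx s hs hsx
    hdim hsoff X₁ τ₁ hτ₁ hX₁reg hX₁dom F₂ υ hυ j₂ t₂ hsq₂ hcomm hcarrier hCh₁ W c hcI hqr hdom θR hθR hframe πk hπk hkerπ πO
    hπOsurj hπO Φ₁ hΦ₁d hΦ₁0 hW g hg0 hR1 hR1' hR2 i aO m hF y' hy'x 𝔮p χp hχp hlocp h𝔮p hfrp S ϖ hϖ ΦS hΦSd hΦSg hΔ K₀ hK₀pr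
    hK₀ hpkg
  rw [hS₀eq] at hmem
  exact hmem

end Summit.ResolutionOfSingularities.ResolutionOfSingularities.Cruxes.EquisingularLiftNat.Sections

end
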